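import Summits.QuantumFields.BalabanUV.T4Continuum.Support.NE3SmoothRightInverseCurl
import Summits.QuantumFields.BalabanUV.T4Continuum.Support.AveragingDeficitTorusChart
import Literature.MathematicalPhysics.QuantumFieldTheory.Balaban1983to89.B6LowerBound2153Torus
import Literature.MathematicalPhysics.QuantumFieldTheory.Balaban1983to89.B5Action121
import HarnessLib

/-!
# NE7TorusBoxDictionary — the box ↔ cubic-torus dictionary in general dimension: period-box sums are torus sums, planes are half the ordered
# pairs, a periodic T4 field reads through `rep ∘ toT`, and ITS FLAT CURL, ENTRYWISE, IS lit-balaban's PLAQUETTE FIELD of its torus restriction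

Cell `pub-balaban`, rung (B)+1 sub-cell t4, lineage `b2b-balaban-t4-ne7-p1`, generation 70 (CRUX PROVER NE7 #1); memo
`t4/b2b-balaban-t4-ne7-p1-g70/HUNT-H14-APE-FLAT-SKELETON.md` §2.  File F40a (the general-`d` forms of F37's `toT_add_e` ∕ `apply_rep_toT` — F37 states
them in dimension `d + 1` for gen 65's constants — plus the two sum conversions used by F40b `NE7FlatHkOrthogonal`).
WHAT ([folklore]; 0 def, 0 sorry).  §1 `periodBox_eq_pbox` (T4's `periodBox N` = lit-balaban's `pbox (N,…,N)`), `sum_periodBox_toT` (complex-valued sums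
over the period box read through `toT` are sums over the cubic torus), `sum_sum_eq_two_mul_sum_plane_complex` (complex form of row NE3's
`NE3LatticeWeitzenbock.sum_sum_eq_two_mul_sum_plane`).  §2 `toT_add_e'`, `apply_add_of_isPeriod'`, `apply_rep_toT'`, **`curlAt_flat_entry_torus`**:
`(curlAt flat Y z μ ν)_{ii′} = Fs (P,…,P) 1 (p ↦ Y(rep p.1, p.2)_{ii′}) μ ν (toT z)` for a `P`-periodic `Y`.
HONEST FRAMING (page 1): index bookkeeping; nothing of Bałaban's asserted; NOT (APE), NOT ONE-STEP, NOT NE7; spine 0∕9; finite T⁴ rung (B)+1 — NOT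
infinite volume, NOT mass gap, NOT Clay.  Continuum YM on T⁴ ⇐ BetaPertH ∧ nine spine estimates (0/9 proved); BetaPertH ⇐ (D1) ∧ (D4) ∧ CAP+tail;
G-an2-4 gates asym, D1 and NE2/3/4.
-/

set_option autoImplicit false

open scoped BigOperators Matrix ComplexConjugate Matrix.Norms.L2Operator
open Finset

namespace Summit.QuantumFields.BalabanUV.T4Continuum.NE7TorusBoxDictionary

open Literature.MathematicalPhysics.QuantumFieldTheory.Balaban1983to89
open B7Prop1Explicit (Site e e_apply)
open T4AveragingDeficitWall (curlAt)
open T4AveragingDeficitWallBoundary (periodBox mem_periodBox)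
open AveragingDeficitPeriodicCounting (IsPeriodicDir)
open B5Prop11Plancherel (Tor)
open B5Action121 (Fs Fs_apply)
open B6Lemma24Torus (pbox mem_pbox IsPeriod)
open B6LowerBound2153Torus (toT rep toT_add toT_rep rep_toT rep_mem_pbox isPeriod_rep_toT_sub)
open BlockAveragePushDirSplit (flat)
open NE3SmoothLiftCurl (curlAt_flat_eq)

noncomputable section

variable {d : ℕ} {n : Type*} [Fintype n] [DecidableEq n]

/-! ## §1 Box ↔ torus, planes ↔ ordered pairs -/

omit [Fintype n] [DecidableEq n] in
/-- The T4 period box `[0,N)^d` is the box of representatives of the cubic torus `(N,…,N)`. [folklore] -/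
theorem periodBox_eq_pbox (N : ℕ) : periodBox (d := d) N = pbox (fun _ : Fin d => N) := by
  ext x
  rw [mem_periodBox, mem_pbox]

omit [Fintype n] [DecidableEq n] in
/-- Sums over the period box read through `toT` are sums over the cubic torus. [folklore] -/
theorem sum_periodBox_toT (N : ℕ) [NeZero N] (g : Tor (fun _ : Fin d => N) → ℂ) :
    ∑ x ∈ periodBox (d := d) N, g (toT (fun _ : Fin d => N) x) = ∑ t : Tor (fun _ : Fin d => N), g t := by
  rw [periodBox_eq_pbox]
  exact Finset.sum_nbij' (fun x => toT (fun _ : Fin d => N) x) (fun t => rep (fun _ : Fin d => N) t) (fun _ _ => Finset.mem_univ _)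
    (fun t _ => rep_mem_pbox _ t) (fun _ hx => rep_toT _ hx) (fun t _ => toT_rep _ t) fun _ _ => rfl

omit [Fintype n] [DecidableEq n] in
/-- Ordered pairs versus planes for a symmetric function with zero diagonal (complex-valued form of
`NE3LatticeWeitzenbock.sum_sum_eq_two_mul_sum_plane`). [folklore] -/
theorem sum_sum_eq_two_mul_sum_plane_complex (g : Fin d → Fin d → ℂ) (hdiag : ∀ μ, g μ μ = 0)
    (hsymm : ∀ μ ν, g μ ν = g ν μ) :
    ∑ μ : Fin d, ∑ ν : Fin d, g μ ν = 2 * ∑ π : T4AveragingDeficitWall.Plane d, g π.1.1 π.1.2 := by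
  classical
  have hsplit : ∀ μ ν : Fin d, g μ ν = (if μ < ν then g μ ν else 0) + (if ν < μ then g μ ν else 0) := by
    intro μ ν
    rcases lt_trichotomy μ ν with h | h | h
    · simp [h, lt_asymm h]
    · subst h; simp [hdiag]
    · simp [h, lt_asymm h]
  have hupper : ∑ μ : Fin d, ∑ ν : Fin d, (if μ < ν then g μ ν else 0) = ∑ π : T4AveragingDeficitWall.Plane d, g π.1.1 π.1.2 := by
    rw [← Fintype.sum_prod_type' (f := fun μ ν : Fin d => if μ < ν then g μ ν else 0), ← Finset.sum_filter]
    exact Finset.sum_subtype _ (fun a => by simp) (fun a : Fin d × Fin d => g a.1 a.2)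
  have hlower : ∑ μ : Fin d, ∑ ν : Fin d, (if ν < μ then g μ ν else 0)
      = ∑ μ : Fin d, ∑ ν : Fin d, (if μ < ν then g μ ν else 0) := by
    calc ∑ μ : Fin d, ∑ ν : Fin d, (if ν < μ then g μ ν else 0)
        = ∑ μ : Fin d, ∑ ν : Fin d, (if ν < μ then g ν μ else 0) :=
          Finset.sum_congr rfl fun μ _ => Finset.sum_congr rfl fun ν _ => by rw [hsymm μ ν]
      _ = ∑ μ : Fin d, ∑ ν : Fin d, (if μ < ν then g μ ν else 0) := Finset.sum_comm
  calc ∑ μ : Fin d, ∑ ν : Fin d, g μ ν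
      = ∑ μ : Fin d, ∑ ν : Fin d, ((if μ < ν then g μ ν else 0) + (if ν < μ then g μ ν else 0)) :=
        Finset.sum_congr rfl fun μ _ => Finset.sum_congr rfl fun ν _ => hsplit μ ν
    _ = 2 * ∑ π : T4AveragingDeficitWall.Plane d, g π.1.1 π.1.2 := by
        simp only [Finset.sum_add_distrib]
        rw [hlower, hupper]
        ring

/-! ## §2 Periodic fields read on the cubic torus -/

omit [Fintype n] [DecidableEq n] in
/-- `toT (x + e_μ) = toT x + unitVec μ` (general dimension). [folklore] -/
theorem toT_add_e' (N : Fin d → ℕ) (x : Site d) (μ : Fin d) : toT N (x + e μ) = toT N x + B5Prop11Plancherel.unitVec N μ := by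
  funext ν
  simp only [toT, Pi.add_apply, e_apply, B5Prop11Plancherel.unitVec]
  by_cases h : ν = μ
  · subst h; simp
  · simp [h]

omit [Fintype n] [DecidableEq n] in
/-- A `P`-periodic direction field is invariant under every period vector of the cubic torus `(P,…,P)`. [folklore] -/
theorem apply_add_of_isPeriod' {P : ℕ} {φ : Site d → Fin d → Matrix n n ℂ} (hφP : IsPeriodicDir φ (P : ℤ)) {v : Site d}
    (hv : IsPeriod (fun _ : Fin d => P) v) (x : Site d) (κ : Fin d) : φ (x + v) κ = φ x κ := by
  have hk : v = (P : ℤ) • fun i => v i / (P : ℤ) := by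
    funext i
    obtain ⟨c, hc⟩ := hv i
    simp only [Pi.smul_apply, smul_eq_mul]
    rw [hc]
    by_cases hP : (P : ℤ) = 0
    · rw [hP]; simp
    · rw [Int.mul_ediv_cancel_left _ hP]
  rw [hk]
  exact AveragingDeficitTorusChart.periodic_smul_vec (f := fun y => φ y κ) (fun y i => hφP y i κ) x _

omit [Fintype n] [DecidableEq n] in
/-- … hence `φ (rep (toT x)) = φ x`. [folklore] -/
theorem apply_rep_toT' {P : ℕ} [NeZero P] {φ : Site d → Fin d → Matrix n n ℂ} (hφP : IsPeriodicDir φ (P : ℤ)) (x : Site d) (κ : Fin d) :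
    φ (rep (fun _ : Fin d => P) (toT (fun _ : Fin d => P) x)) κ = φ x κ := by
  have h := isPeriod_rep_toT_sub (fun _ : Fin d => P) x
  have e1 : rep (fun _ : Fin d => P) (toT (fun _ : Fin d => P) x) = x + (rep (fun _ : Fin d => P) (toT (fun _ : Fin d => P) x) - x) := by
    abel
  rw [e1, apply_add_of_isPeriod' hφP h]

/-- **THE FLAT CURL OF A PERIODIC FIELD, ENTRYWISE, IS lit-balaban's PLAQUETTE FIELD OF ITS TORUS RESTRICTION**:
`(curlAt flat Y z μ ν) i i' = Fs (P,…,P) 1 (p ↦ Y (rep p.1) p.2 i i') μ ν (toT z)`. [folklore] -/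
theorem curlAt_flat_entry_torus {P : ℕ} [NeZero P] {Y : Site d → Fin d → Matrix n n ℂ} (hYP : IsPeriodicDir Y (P : ℤ))
    (z : Site d) (μ ν : Fin d) (i i' : n) :
    curlAt (flat (d := d) (n := n)) Y z μ ν i i'
      = Fs (fun _ : Fin d => P) 1 (fun p : Tor (fun _ : Fin d => P) × Fin d => Y (rep (fun _ : Fin d => P) p.1) p.2 i i') μ ν
          (toT (fun _ : Fin d => P) z) := by
  rw [curlAt_flat_eq, Fs_apply, one_mul, ← toT_add_e', ← toT_add_e']
  simp only [apply_rep_toT' hYP, Matrix.sub_apply]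
  ring

end

end Summit.QuantumFields.BalabanUV.T4Continuum.NE7TorusBoxDictionary
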